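import Literature.Geometry.Kaehler.ComplexTorusFourierLefschetzIntertwining
import HarnessLib

/-!
# Voisin's dual Lefschetz operator is self-adjoint for the cup-product pairing of a polarised complex torus:
# `⟨Λ_η x, y⟩ = ⟨x, Λ_η y⟩` — a proof by the Fourier transform

[cite: Huybrechts2005, §1.2 Def. 1.2.21 and Lemma 1.2.23 (p. 33–34: `Λ` is the `⟨ , ⟩`-adjoint of `L`, `Λ = ⋆⁻¹ ∘ L ∘ ⋆`)]
[cite: Voisin2002, §6.2.1 Lemma 6.19]
[cite: Lange2023AbelianVarietiesComplex, §6.2.4 Prop. 6.2.20 (pp. 310–311: Parseval for the cohomological Fourier transform)]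
[cite: Polishchuk2007FourierStable, §1 (p. 3: "`F_d f F_d⁻¹ = −e`")]

Row g50-#6 of the `lit-hodgefound` p09 lineage. SETTING: `X = E/Φ(ℤ^ι)` a complex torus with a Riemann form `η = E` of type
`(d₁, …, d_g)` on its lattice (`IsPolarizationType Φ η d`, `d : Fin (j + 2) → ℕ`, `g = j + 2 ≥ 2`; any lattice basis),
`Λ_η = lefschetzDual η m : H^{m+2}(X, ℂ) → Hᵐ(X, ℂ)` Voisin's dual Lefschetz operator, `⟨ , ⟩_e = poincarePairing Φ e h` the cup-product
pairing `(x, y) ↦ (x ∧ y)(λ_{e(1)}, …, λ_{e(2g)})` of complementary degrees on a lattice frame `e`.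

THE RESULT: **`⟨Λ_η x, y⟩_e = ⟨x, Λ_η y⟩_e`** for all complex forms `x` of degree `m + 2` and `y` of degree `m' + 2`, `m + m' + 2 = 2g`
(`IsPolarizationType.poincarePairing_lefschetzDual_comm`): the `sl₂`-partner of `L_η` is SYMMETRIC for the intersection pairing (as `L_η`
itself is). In the textbooks `Λ` is introduced as the adjoint of `L` for the Hodge METRIC (Huybrechts Def. 1.2.21, Voisin Lemma 6.19;
the tree's `torusFormInnerC_lefschetz_adjoint`); its symmetry for the CUP PRODUCT pairing is proved here by the Fourier transform, in
three printed steps: Parseval `⟨F a, F b⟩_X̂ = ±⟨a, b⟩_X` in all degrees (Prop. 6.2.20, `poincarePairing_fourierForm_fourierForm_of_add`),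
the intertwining `F(Λ_η x) = −E^* ∧ F(x)` of row g50-#4 (Polishchuk's "`F f F⁻¹ = −e`", every lattice basis), and the symmetry of
`L_{E^*} = E^* ∧ ·` on `X̂` (associativity and graded commutativity of `∧`); the signs `(−1)^{g + m(m'+2)} = (−1)^{g + (m+2)m'}` and
`(−1)^{(m+2)m' + m'm} = 1` cancel. First for rational classes (`…_of_mem_rationalForms`, where `F` lives), then for all complex forms by
bilinearity on the basis of lattice monomials (`latMonomialBasis`, which consists of rational classes).

* §0 (private) degree casts for `F` and `⟨ , ⟩`, `⟨s, b ∧ x⟩ = ⟨s ∧ b, x⟩`, `⟨s, x ∧ b⟩ = (−1)^{jl}⟨s ∧ b, x⟩`.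
* §1 `IsPolarizationType.poincarePairing_fourierForm_lefschetzDual_eq` (`⟨F(Λx), F y⟩ = ⟨F x, F(Λ y)⟩` on `X̂`),
  `IsPolarizationType.poincarePairing_lefschetzDual_comm_of_mem_rationalForms`,
  **`IsPolarizationType.poincarePairing_lefschetzDual_comm`**, `IsRiemannForm.poincarePairing_lefschetzDual_comm` (`dim X ≥ 2`).

## References

* [cite: Huybrechts2005, §1.2 Def. 1.2.21, Lemma 1.2.23]
* [cite: Voisin2002, §6.2.1 Lemma 6.19]
* [cite: Lange2023AbelianVarietiesComplex, §6.2.4 Prop. 6.2.20 (pp. 310–311); §1.4.1 (p. 37)]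
* [cite: Polishchuk2007FourierStable, §1 (p. 3)]
* [cite: Warner1983, 2.6]
-/

noncomputable section

-- `Module ℂ` / `SMulZeroClass ℂ` synthesis on `E [⋀^Fin k]→L[ℝ] ℂ` (as in `ComplexTorusLefschetzDecomposition`)
set_option maxSynthPendingDepth 3

open Module Function Complex
open Literature.LinearAlgebra.Alternating

namespace Literature.Geometry.Kaehler.ComplexTorus

universe uE

/-! ## §0 Degree bookkeeping under the cup-product pairing (private) -/

section Casts

variable {ι : Type*} [LinearOrder ι] {F : Type*} [NormedAddCommGroup F] [NormedSpace ℂ F]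
  (Ψ : (ι → ℝ) ≃L[ℝ] F) {N : ℕ} (e : Fin N ≃ ι)

/-- Re-reading the degree of the first argument of the pairing along `k₁ = k₂`. [cite: Lange2023AbelianVarietiesComplex, §6.2.4 (p. 310)] -/
private theorem poincarePairing_domDomCongr_left₁₀₈ {k₁ k₂ l : ℕ} (hk : k₁ = k₂) (h₁ : k₁ + l = N) (h₂ : k₂ + l = N)
    (γ : F [⋀^Fin k₁]→L[ℝ] ℂ) (δ : F [⋀^Fin l]→L[ℝ] ℂ) :
    poincarePairing Ψ e h₂ (γ.domDomCongr (finCongr hk)) δ = poincarePairing Ψ e h₁ γ δ := by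
  subst hk
  rfl

/-- Re-reading the degree of the second argument of the pairing along `l₁ = l₂`. [cite: Lange2023AbelianVarietiesComplex, §6.2.4 (p. 310)] -/
private theorem poincarePairing_domDomCongr_right₁₀₈ {k l₁ l₂ : ℕ} (hl : l₁ = l₂) (h₁ : k + l₁ = N) (h₂ : k + l₂ = N)
    (γ : F [⋀^Fin k]→L[ℝ] ℂ) (δ : F [⋀^Fin l₁]→L[ℝ] ℂ) :
    poincarePairing Ψ e h₂ γ (δ.domDomCongr (finCongr hl)) = poincarePairing Ψ e h₁ γ δ := by
  subst hl
  rfl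

/-- `⟨s, b ∧ x⟩_e = ⟨s ∧ b, x⟩_e` (associativity of `∧`; copy of the tree's `poincarePairing_wedge_right`, whose module is not imported
here). [cite: Warner1983, 2.6] [cite: Lange2023AbelianVarietiesComplex, §1.4.1 (p. 37)] -/
private theorem poincarePairing_wedge_right₁₀₈ {a j l : ℕ} (h₁ : a + (j + l) = N) (h₂ : a + j + l = N)
    (s : F [⋀^Fin a]→L[ℝ] ℂ) (b : F [⋀^Fin j]→L[ℝ] ℂ) (x : F [⋀^Fin l]→L[ℝ] ℂ) :
    poincarePairing Ψ e h₁ s (b.wedge x) = poincarePairing Ψ e h₂ (s.wedge b) x := by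
  simp only [poincarePairing_apply]
  have hA := ContinuousAlternatingMap.WedgeAssoc_holds ℝ F ℂ s b x
  have hev := congrArg (fun φ : F [⋀^Fin (a + j + l)]→L[ℝ] ℂ ↦ φ (orderedBasis Ψ e ∘ Fin.cast h₂)) hA
  simp only [ContinuousAlternatingMap.domDomCongr_apply] at hev
  convert hev.symm using 2
  exact funext fun _ ↦ rfl

/-- `⟨s, x ∧ b⟩_e = (−1)^{jl}·⟨s ∧ b, x⟩_e` (graded commutativity, then associativity; copy of the tree's
`poincarePairing_wedge_right_comm`). [cite: Warner1983, 2.6 and 2.10] [cite: Lange2023AbelianVarietiesComplex, §1.4.1 (p. 37)] -/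
private theorem poincarePairing_wedge_right_comm₁₀₈ {a j l : ℕ} (h₁ : a + (l + j) = N) (h₂ : a + j + l = N)
    (s : F [⋀^Fin a]→L[ℝ] ℂ) (b : F [⋀^Fin j]→L[ℝ] ℂ) (x : F [⋀^Fin l]→L[ℝ] ℂ) :
    poincarePairing Ψ e h₁ s (x.wedge b) = (-1 : ℂ) ^ (j * l) * poincarePairing Ψ e h₂ (s.wedge b) x := by
  rw [← poincarePairing_wedge_right₁₀₈ Ψ e (by omega : a + (j + l) = N) h₂ s b x]
  simp only [poincarePairing_apply]
  rw [ContinuousAlternatingMap.WedgeComm_holds ℝ F ℂ b x, ContinuousAlternatingMap.wedge_smul_right,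
    wedge_domDomCongr_finCongr (Nat.add_comm j l) s (b.wedge x), ContinuousAlternatingMap.smul_apply,
    ContinuousAlternatingMap.domDomCongr_apply, Complex.real_smul, Complex.ofReal_pow, Complex.ofReal_neg,
    Complex.ofReal_one]
  exact congrArg ((-1 : ℂ) ^ (j * l) * ·) (congrArg _ (funext fun _ ↦ rfl))

end Casts

section FourierCast

variable {ι : Type*} [Fintype ι] [LinearOrder ι] {E : Type uE} [NormedAddCommGroup E] [NormedSpace ℂ E]
  (Φ : (ι → ℝ) ≃L[ℝ] E) {N : ℕ} (e : Fin N ≃ ι)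

/-- Re-reading the output degree of the Fourier transform along `m₁ = m₂`. [cite: Lange2023AbelianVarietiesComplex, §6.2.4 (6.11) (p. 311)] -/
private theorem fourierForm_degree_cast₁₀₈ {p m₁ m₂ : ℕ} (hm : m₁ = m₂) (h₁ : p + m₁ = N) (h₂ : p + m₂ = N)
    (x : E [⋀^Fin p]→L[ℝ] ℂ) : fourierForm Φ e h₂ x = (fourierForm Φ e h₁ x).domDomCongr (finCongr hm) := by
  subst hm
  rfl

end FourierCast

/-! ## §1 `⟨Λ_η x, y⟩ = ⟨x, Λ_η y⟩` -/

section SelfAdjoint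

variable {ι : Type*} [Fintype ι] [LinearOrder ι] {E : Type uE} [NormedAddCommGroup E] [NormedSpace ℂ E]
  [FiniteDimensional ℂ E] (Φ : (ι → ℝ) ≃L[ℝ] E) {j N m m' : ℕ} {η : E [⋀^Fin 2]→L[ℝ] ℝ} {d : Fin (j + 2) → ℕ}

/-- **`⟨F(Λ_η x), F y⟩_X̂ = ⟨F x, F(Λ_η y)⟩_X̂`** for rational classes `x ∈ H^{m+2}(X, ℚ)`, `y ∈ H^{m'+2}(X, ℚ)` (`m + m' + 2 = 2g`), all four
Fourier transforms read on one lattice frame `e`: both sides equal `−⟨E^* ∧ F x, F y⟩_X̂` by the intertwining `F(Λ_η z) = −E^* ∧ F z`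
(row g50-#4) and the symmetry of `E^* ∧ ·` for the cup-product pairing of `X̂` (`(−1)^{(m+2)m' + m'm} = 1`).
[cite: Polishchuk2007FourierStable, §1 (p. 3)] [cite: Lange2023AbelianVarietiesComplex, §6.2.3 Prop. 6.2.18 (a); §1.4.1 (p. 37)] -/
theorem IsPolarizationType.poincarePairing_fourierForm_lefschetzDual_eq (hd : IsPolarizationType Φ η d) (hη : IsRiemannForm Φ η)
    (e : Fin N ≃ ι) (h₁ : m + (m' + 2) = N) (h₁' : (m' + 2) + m = N) (h₂ : (m + 2) + m' = N) (h₂' : m' + (m + 2) = N)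
    (x : rationalForms Φ (m + 2)) (y : rationalForms Φ (m' + 2)) :
    poincarePairing (dualPeriod Φ) e h₁' (fourierForm Φ e h₁ (lefschetzDual η m x))
        (fourierForm Φ e h₁' (y : E [⋀^Fin (m' + 2)]→L[ℝ] ℂ)) =
      poincarePairing (dualPeriod Φ) e h₂' (fourierForm Φ e h₂ (x : E [⋀^Fin (m + 2)]→L[ℝ] ℂ))
        (fourierForm Φ e h₂' (lefschetzDual η m' y)) := by
  have hΛ : m + (2 + m') = N := by omega
  have hΛ' : m' + (2 + m) = N := by omega
  have h₃ : (2 + m') + m = N := by omega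
  have h₆ : (2 + m) + m' = N := by omega
  have h₇ : 2 + (m + m') = N := by omega
  have hsgn : (-1 : ℂ) ^ ((2 + m) * m') * (-1) ^ (m' * m) = 1 := by
    rw [← pow_add, show (2 + m) * m' + m' * m = 2 * (m' + m * m') by ring, pow_mul, neg_one_sq, one_pow]
  -- `F(Λ x) = −E^* ∧ F x` and `F(Λ y) = −E^* ∧ F y`, read in the frame `e`
  have hFx : fourierForm Φ e h₁ (lefschetzDual η m x) =
      (-(ofRealForm (dualForm Φ hη.1 hη.nondegenerate)).wedge
        (fourierForm Φ e h₂ (x : E [⋀^Fin (m + 2)]→L[ℝ] ℂ))).domDomCongr (finCongr (Nat.add_comm 2 m')) := by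
    rw [fourierForm_degree_cast₁₀₈ Φ e (Nat.add_comm 2 m') hΛ h₁,
      fourierForm_eq_fourierForm_of_eq Φ e ((finCongr hΛ).trans e) hΛ rfl,
      hd.fourierForm_lefschetzDual Φ hη ((finCongr h₂).trans e) ((finCongr hΛ).trans e) x,
      ← fourierForm_eq_fourierForm_of_eq Φ e ((finCongr h₂).trans e) h₂ rfl]
  have hFy : fourierForm Φ e h₂' (lefschetzDual η m' y) =
      (-(ofRealForm (dualForm Φ hη.1 hη.nondegenerate)).wedge
        (fourierForm Φ e h₁' (y : E [⋀^Fin (m' + 2)]→L[ℝ] ℂ))).domDomCongr (finCongr (Nat.add_comm 2 m)) := by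
    rw [fourierForm_degree_cast₁₀₈ Φ e (Nat.add_comm 2 m) hΛ' h₂',
      fourierForm_eq_fourierForm_of_eq Φ e ((finCongr hΛ').trans e) hΛ' rfl,
      hd.fourierForm_lefschetzDual Φ hη ((finCongr h₁').trans e) ((finCongr hΛ').trans e) y,
      ← fourierForm_eq_fourierForm_of_eq Φ e ((finCongr h₁').trans e) h₁' rfl]
  rw [hFx, hFy, poincarePairing_domDomCongr_left₁₀₈ (dualPeriod Φ) e (Nat.add_comm 2 m') h₃ h₁',
    poincarePairing_domDomCongr_right₁₀₈ (dualPeriod Φ) e (Nat.add_comm 2 m) hΛ' h₂', LinearMap.map_neg₂, map_neg,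
    poincarePairing_comm (dualPeriod Φ) e h₆ hΛ', ← poincarePairing_wedge_right₁₀₈ (dualPeriod Φ) e h₇ h₆,
    poincarePairing_wedge_right_comm₁₀₈ (dualPeriod Φ) e h₇ h₃, ← mul_assoc, hsgn, one_mul]

/-- **`⟨Λ_η x, y⟩ = ⟨x, Λ_η y⟩` on rational classes**, `x ∈ H^{m+2}(X, ℚ)`, `y ∈ H^{m'+2}(X, ℚ)`, `m + m' + 2 = 2g`: Parseval
`⟨F a, F b⟩_X̂ = (−1)^{g + deg a · deg b}⟨a, b⟩_X` (Prop. 6.2.20) on both sides of `poincarePairing_fourierForm_lefschetzDual_eq`, the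
two signs `(−1)^{g + m(m'+2)}`, `(−1)^{g + (m+2)m'}` being equal. [cite: Lange2023AbelianVarietiesComplex, §6.2.4 Prop. 6.2.20 (pp. 310–311)]
[cite: Polishchuk2007FourierStable, §1 (p. 3)] [cite: Huybrechts2005, §1.2 Def. 1.2.21, Lemma 1.2.23] -/
theorem IsPolarizationType.poincarePairing_lefschetzDual_comm_of_mem_rationalForms (hd : IsPolarizationType Φ η d)
    (hη : IsRiemannForm Φ η) (e : Fin N ≃ ι) (h₁ : m + (m' + 2) = N) (h₂ : (m + 2) + m' = N)
    (x : rationalForms Φ (m + 2)) (y : rationalForms Φ (m' + 2)) :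
    poincarePairing Φ e h₁ (lefschetzDual η m x) y =
      poincarePairing Φ e h₂ (x : E [⋀^Fin (m + 2)]→L[ℝ] ℂ) (lefschetzDual η m' y) := by
  have h₁' : (m' + 2) + m = N := by omega
  have h₂' : m' + (m + 2) = N := by omega
  have hP₁ := poincarePairing_fourierForm_fourierForm_of_add Φ e h₁ h₁' (lefschetzDual η m x)
    (y : E [⋀^Fin (m' + 2)]→L[ℝ] ℂ)
  have hP₂ := poincarePairing_fourierForm_fourierForm_of_add Φ e h₂ h₂' (x : E [⋀^Fin (m + 2)]→L[ℝ] ℂ)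
    (lefschetzDual η m' y)
  have key : (-1 : ℂ) ^ (finrank ℂ E + m * (m' + 2)) * poincarePairing Φ e h₁ (lefschetzDual η m x) y =
      (-1 : ℂ) ^ (finrank ℂ E + (m + 2) * m') *
        poincarePairing Φ e h₂ (x : E [⋀^Fin (m + 2)]→L[ℝ] ℂ) (lefschetzDual η m' y) := by
    rw [← hP₁, ← hP₂, hd.poincarePairing_fourierForm_lefschetzDual_eq Φ hη e h₁ h₁' h₂ h₂' x y]
  have hs₁ : (-1 : ℂ) ^ (finrank ℂ E + m * (m' + 2)) = (-1) ^ finrank ℂ E * (-1) ^ (m * m') := by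
    rw [show m * (m' + 2) = m * m' + 2 * m by ring, pow_add, pow_add, pow_mul (-1 : ℂ) 2 m, neg_one_sq, one_pow, mul_one]
  have hs₂ : (-1 : ℂ) ^ (finrank ℂ E + (m + 2) * m') = (-1) ^ finrank ℂ E * (-1) ^ (m * m') := by
    rw [show (m + 2) * m' = m * m' + 2 * m' by ring, pow_add, pow_add, pow_mul (-1 : ℂ) 2 m', neg_one_sq, one_pow, mul_one]
  rw [hs₁, hs₂] at key
  exact mul_left_cancel₀ (mul_ne_zero (pow_ne_zero _ (by norm_num)) (pow_ne_zero _ (by norm_num))) key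

/-- **VOISIN'S `Λ_η` IS SELF-ADJOINT FOR THE CUP-PRODUCT PAIRING: `⟨Λ_η x, y⟩_e = ⟨x, Λ_η y⟩_e`** for ALL complex forms `x` of degree
`m + 2` and `y` of degree `m' + 2` on a polarised complex torus of dimension `g = j + 2 ≥ 2` (`m + m' + 2 = 2g`; `η` a Riemann form of any
type, any lattice basis, any frame `e`). From the rational case by `ℂ`-bilinearity on the basis of lattice monomials (rational classes).
In the texts `Λ` is the adjoint of `L` for the Hodge metric (Huybrechts Def. 1.2.21, `Λ = ⋆⁻¹L⋆` Lemma 1.2.23; Voisin Lemma 6.19); here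
its symmetry for the INTERSECTION pairing is obtained from the Fourier transform (Parseval, Prop. 6.2.20, and "`F f F⁻¹ = −e`").
[cite: Huybrechts2005, §1.2 Def. 1.2.21, Lemma 1.2.23] [cite: Voisin2002, §6.2.1 Lemma 6.19]
[cite: Lange2023AbelianVarietiesComplex, §6.2.4 Prop. 6.2.20 (pp. 310–311)] [cite: Polishchuk2007FourierStable, §1 (p. 3)] -/
theorem IsPolarizationType.poincarePairing_lefschetzDual_comm (hd : IsPolarizationType Φ η d) (hη : IsRiemannForm Φ η)
    (e : Fin N ≃ ι) (h₁ : m + (m' + 2) = N) (h₂ : (m + 2) + m' = N)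
    (x : E [⋀^Fin (m + 2)]→L[ℝ] ℂ) (y : E [⋀^Fin (m' + 2)]→L[ℝ] ℂ) :
    poincarePairing Φ e h₁ (lefschetzDual η m x) y = poincarePairing Φ e h₂ x (lefschetzDual η m' y) := by
  have key : (poincarePairing Φ e h₁).comp (lefschetzDual η m) = (poincarePairing Φ e h₂).compl₂ (lefschetzDual η m') := by
    refine (latMonomialBasis Φ (m + 2)).ext fun w ↦ (latMonomialBasis Φ (m' + 2)).ext fun w' ↦ ?_
    rw [LinearMap.comp_apply, LinearMap.compl₂_apply, latMonomialBasis_apply, latMonomialBasis_apply]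
    exact hd.poincarePairing_lefschetzDual_comm_of_mem_rationalForms Φ hη e h₁ h₂
      ⟨latMonomial Φ (m + 2) w.1, latMonomial_mem_rationalForms Φ (m + 2) w.1⟩
      ⟨latMonomial Φ (m' + 2) w'.1, latMonomial_mem_rationalForms Φ (m' + 2) w'.1⟩
  have h := congrArg (fun B ↦ B x y) key
  simpa only [LinearMap.comp_apply, LinearMap.compl₂_apply] using h

/-- **`⟨Λ_η x, y⟩ = ⟨x, Λ_η y⟩` for every polarised complex torus of dimension `≥ 2`** (`η` any Riemann form on the lattice of `X`, via
its type `(d₁, …, d_g)` given by the elementary divisor theorem, `IsRiemannForm.exists_isPolarizationType`).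
[cite: Huybrechts2005, §1.2 Def. 1.2.21, Lemma 1.2.23] [cite: Lange2023AbelianVarietiesComplex, §6.2.4 Prop. 6.2.20; §1.5.1 (p. 51)] -/
theorem IsRiemannForm.poincarePairing_lefschetzDual_comm (hη : IsRiemannForm Φ η) (hg : 4 ≤ Fintype.card ι)
    (e : Fin N ≃ ι) (h₁ : m + (m' + 2) = N) (h₂ : (m + 2) + m' = N)
    (x : E [⋀^Fin (m + 2)]→L[ℝ] ℂ) (y : E [⋀^Fin (m' + 2)]→L[ℝ] ℂ) :
    poincarePairing Φ e h₁ (lefschetzDual η m x) y = poincarePairing Φ e h₂ x (lefschetzDual η m' y) := by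
  obtain ⟨g, d', hd', -⟩ := hη.exists_isPolarizationType
  have hcard := hd'.card_eq
  obtain ⟨j', rfl⟩ : ∃ j', g = j' + 2 := ⟨g - 2, by omega⟩
  exact hd'.poincarePairing_lefschetzDual_comm Φ hη e h₁ h₂ x y

end SelfAdjoint

end Literature.Geometry.Kaehler.ComplexTorus

end
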